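import Summits.ResolutionOfSingularities.ResolutionOfSingularities.Theorems.FrobeniusLadderFInjectiveMacaulayficationOmegaCrossingCureFanCert
import Summits.ResolutionOfSingularities.ResolutionOfSingularities.Theorems.FrobeniusLadderFInjectiveMacaulayficationOmegaLocalCureRowAllPoints
import HarnessLib

/-!
# Ω₁ GLOBAL ROW, MODEL #4 «G9∧10»: THE LOCAL CURE ROW AT THE CROSSINGS `P_ζ = Γ₉ ∩ Γ₁₀` — every cone chart of `Σ₄`, BOTH pencil charts, EVERY point, `p ≥ 5`, any field
# (crux `FInjectiveMacaulayfication` stmt-ResolutionOfSingularities-15315, chain w45a; res-L1-w45a-plan-1 RULING R23.17 (2); seat res-L1-w45a-stub-3 g13; data ✓ `OmegaCrossingCureFanCert`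
# (kit j327399), soundness = res-L1-w45a-stub-1ʼs MASTER ✓p701797 through ✓p702704 / ✓ `OmegaLocalCureRowAllPoints`)

[OURS · L1 W4.5a] Support file (`--supports stmt-ResolutionOfSingularities-15315 --as helper`); theorems only; no definitions, no named facts. Nothing of the crux is proved; the census
letter «CURED» for Ω₁ (the scheme-level GLOBAL patch) is NOT claimed here. AI-written (AI review is weaker than expert review).

THE OBJECTS. For a cone `σ` of `Σ₄` (rows `ρ₁..ρ₄`, letters `(a, b, c₉, c₁₀)`) the marked ideal `(c₉²²c₁₀⁴³, a² − b³)` pulls back to `y^G·(y^{M₁}, y^{M₂}(y^r − y^s))` with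
`C = 22ρ[2] + 43ρ[3]`, `A = 2ρ[0]`, `B = 3ρ[1]` — computed below by the landed `exitOK` letter on the TRANSFORMED rays `RAYST_G4` (`e = 1`, `CI = 2`; ✓ `rayst_G4_eq`); the two pencil
charts are `V(Φ_W)`, `Φ_W = (y^{M₁})⁺·W − (y^{M₂}(y^r − y^s))⁺ ⊂ 𝔸⁵` and `V(Φ_U)`. THE ROW: for every prime `p ≥ 5`, every field `k` of characteristic `p`, every `σ ∈ CONES_G4` and EVERY
point `y` of either chart: `FullCl p 𝒪_{V(Φ),y}`.
* ★★★ `omega1_G4_pencilChartW_fullCl_allPoints`, ★★★ `omega1_G4_pencilChartU_fullCl_allPoints`; rational-point forms `omega1_G4_pencilChartW_fullCl` / `…U_fullCl` (every `w₀` / `u₀`);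
  ★★ `face10_G10Q` (third gluing equality `G10Q|{x₀=0} = G10`, R23.23 (1)/R23.24) and `omega1_fan_of_record_glues` (the three restriction equalities + E-adaptedness of all four fans).
[cite: Fedder1983, Thm. 1.12; CoxLittleSchenck2011, §2.3]
-/

set_option linter.dupNamespace false

noncomputable section

open AlgebraicGeometry IsLocalRing MvPolynomial
open scoped Pointwise

namespace Summit.ResolutionOfSingularities.ResolutionOfSingularities.Theorems.FInjectiveMacaulayfication.OmegaCrossingCureRow

open Summit.ResolutionOfSingularities.ResolutionOfSingularities.Theorems.FInjectiveMacaulayfication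
open FanCheckKit FanCheckSound OmegaOneCureFanCert OmegaOneCureFanCertStrong OmegaCrossingCureFanCert OmegaExitBridge OmegaLocalCureRow OmegaLocalCureRowAllPoints SliceableCentre

variable (k : Type) [Field k] (p : ℕ) [Fact p.Prime] [CharP k p]

/-- ★★★ **MODEL #4 (crossings `P_ζ`), `W`-CHARTS, EVERY POINT**: for every cone `σ` of `Σ₄` and every point `y` of the `W`-pencil chart `V(Φ_W(σ)) ⊂ 𝔸⁵_k`: `FullCl p 𝒪_y`
(`p ≥ 5`, `k` any field of characteristic `p`). [OURS · Ω₁ global row, model #4; cite: Fedder1983, Thm. 1.12] -/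
theorem omega1_G4_pencilChartW_fullCl_allPoints (hp5 : 5 ≤ p) (σ : List ℕ) (hσ : σ ∈ CONES_G4) :
    let rows := raysOf RAYST_G4 σ
    let Cv := rows.map fun ρ => 1 * getL ρ 2 0
    let Av := rows.map fun ρ => dotL ρ [2, 0, 0, 0]
    let Bv := rows.map fun ρ => dotL ρ [0, 3, 0, 0]
    let mv := vmin Av Bv
    let Gv := vmin Cv mv
    let M₁ := expOf 4 (vsub Cv Gv)
    let M₂ := expOf 4 (vsub mv Gv)
    let r := expOf 4 (vsub Av mv)
    let s := expOf 4 (vsub Bv mv)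
    let Φ : MvPolynomial (Fin 5) k := rename Fin.succ (monomial M₁ (1 : k)) * X 0 - rename Fin.succ (monomial M₂ (1 : k) * (monomial r 1 - monomial s 1))
    ∀ (y : Spec (.of (MvPolynomial (Fin 5) k ⧸ Ideal.span {Φ}))), FullCl p ((Spec (.of (MvPolynomial (Fin 5) k ⧸ Ideal.span {Φ}))).presheaf.stalk y) :=
  fullCl_pencilChartW_allPoints_of_checkExits' k p hp5 4 1 2 [2, 0, 0, 0] [0, 3, 0, 0] RAYST_G4 CONES_G4 ORB4 TAGS_G4 cert'_G4 orb4_complete sides_G4.1 sides_G4.2 σ hσ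

/-- ★★★ **MODEL #4 (crossings `P_ζ`), `U`-CHARTS, EVERY POINT.** [OURS · Ω₁ global row, model #4; cite: Fedder1983, Thm. 1.12] -/
theorem omega1_G4_pencilChartU_fullCl_allPoints (hp5 : 5 ≤ p) (σ : List ℕ) (hσ : σ ∈ CONES_G4) :
    let rows := raysOf RAYST_G4 σ
    let Cv := rows.map fun ρ => 1 * getL ρ 2 0
    let Av := rows.map fun ρ => dotL ρ [2, 0, 0, 0]
    let Bv := rows.map fun ρ => dotL ρ [0, 3, 0, 0]
    let mv := vmin Av Bv
    let Gv := vmin Cv mv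
    let M₁ := expOf 4 (vsub Cv Gv)
    let M₂ := expOf 4 (vsub mv Gv)
    let r := expOf 4 (vsub Av mv)
    let s := expOf 4 (vsub Bv mv)
    let Φ : MvPolynomial (Fin 5) k := rename Fin.succ (monomial M₂ (1 : k) * (monomial r 1 - monomial s 1)) * X 0 - rename Fin.succ (monomial M₁ (1 : k))
    ∀ (y : Spec (.of (MvPolynomial (Fin 5) k ⧸ Ideal.span {Φ}))), FullCl p ((Spec (.of (MvPolynomial (Fin 5) k ⧸ Ideal.span {Φ}))).presheaf.stalk y) :=
  fullCl_pencilChartU_allPoints_of_checkExits' k p hp5 4 1 2 [2, 0, 0, 0] [0, 3, 0, 0] RAYST_G4 CONES_G4 ORB4 TAGS_G4 cert'_G4 orb4_complete sides_G4.1 sides_G4.2 σ hσ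

/-- **MODEL #4, `W`-CHARTS, RATIONAL POINTS** (every `w₀`; the form with explicit coordinates `(w₀; c)`). [OURS; cite: Fedder1983, Thm. 1.12] -/
theorem omega1_G4_pencilChartW_fullCl (hp5 : 5 ≤ p) (σ : List ℕ) (hσ : σ ∈ CONES_G4) :
    let rows := raysOf RAYST_G4 σ
    let Cv := rows.map fun ρ => 1 * getL ρ 2 0
    let Av := rows.map fun ρ => dotL ρ [2, 0, 0, 0]
    let Bv := rows.map fun ρ => dotL ρ [0, 3, 0, 0]
    let mv := vmin Av Bv
    let Gv := vmin Cv mv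
    let M₁ := expOf 4 (vsub Cv Gv)
    let M₂ := expOf 4 (vsub mv Gv)
    let r := expOf 4 (vsub Av mv)
    let s := expOf 4 (vsub Bv mv)
    let Φ : MvPolynomial (Fin 5) k := rename Fin.succ (monomial M₁ (1 : k)) * X 0 - rename Fin.succ (monomial M₂ (1 : k) * (monomial r 1 - monomial s 1))
    ∀ (c : Fin 4 → k) (w₀ : k) (y : Spec (.of (MvPolynomial (Fin 5) k ⧸ Ideal.span {Φ}))), y.asIdeal.IsMaximal →
      y.asIdeal.comap (Ideal.Quotient.mk (Ideal.span {Φ})) = Ideal.span (Set.range (Fin.cons ((X 0 : MvPolynomial (Fin 5) k) - C w₀) fun i : Fin 4 => X i.succ - C (c i))) →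
      FullCl p ((Spec (.of (MvPolynomial (Fin 5) k ⧸ Ideal.span {Φ}))).presheaf.stalk y) :=
  fullCl_pencilChartW_of_checkExits' k p hp5 4 1 2 [2, 0, 0, 0] [0, 3, 0, 0] RAYST_G4 CONES_G4 ORB4 TAGS_G4 cert'_G4 orb4_complete sides_G4.1 sides_G4.2 σ hσ

/-- **MODEL #4, `U`-CHARTS, RATIONAL POINTS** (every `u₀`). [OURS; cite: Fedder1983, Thm. 1.12] -/
theorem omega1_G4_pencilChartU_fullCl (hp5 : 5 ≤ p) (σ : List ℕ) (hσ : σ ∈ CONES_G4) :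
    let rows := raysOf RAYST_G4 σ
    let Cv := rows.map fun ρ => 1 * getL ρ 2 0
    let Av := rows.map fun ρ => dotL ρ [2, 0, 0, 0]
    let Bv := rows.map fun ρ => dotL ρ [0, 3, 0, 0]
    let mv := vmin Av Bv
    let Gv := vmin Cv mv
    let M₁ := expOf 4 (vsub Cv Gv)
    let M₂ := expOf 4 (vsub mv Gv)
    let r := expOf 4 (vsub Av mv)
    let s := expOf 4 (vsub Bv mv)
    let Φ : MvPolynomial (Fin 5) k := rename Fin.succ (monomial M₂ (1 : k) * (monomial r 1 - monomial s 1)) * X 0 - rename Fin.succ (monomial M₁ (1 : k))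
    ∀ (c : Fin 4 → k) (u₀ : k) (y : Spec (.of (MvPolynomial (Fin 5) k ⧸ Ideal.span {Φ}))), y.asIdeal.IsMaximal →
      y.asIdeal.comap (Ideal.Quotient.mk (Ideal.span {Φ})) = Ideal.span (Set.range (Fin.cons ((X 0 : MvPolynomial (Fin 5) k) - C u₀) fun i : Fin 4 => X i.succ - C (c i))) →
      FullCl p ((Spec (.of (MvPolynomial (Fin 5) k ⧸ Ideal.span {Φ}))).presheaf.stalk y) :=
  fullCl_pencilChartU_of_checkExits' k p hp5 4 1 2 [2, 0, 0, 0] [0, 3, 0, 0] RAYST_G4 CONES_G4 ORB4 TAGS_G4 cert'_G4 orb4_complete sides_G4.1 sides_G4.2 σ hσ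


/-! ## Gluing record: the four local cure fans of the Ω₁ global row are restrictions of one another -/

/-- ★★ **THIRD GLUING EQUALITY (R23.23 (1) / R23.24)**: the certified `Q*` fan `G10Q` of ✓p694236 restricted to its facet `{x₀ = 0}` (`x′` a unit, i.e. along `Γ₁₀ ∖ {Q*}`) IS the Γ₁₀ fan
`G10`, on the nose — so the fan of record {F9 along Γ₉ · F10 along Γ₁₀ · Σ₄ at the nine `P_ζ` (✓ `face9_G4`, ✓ `face10_G4`) · G10Q at `Q*`} is ONE object by three restriction
equalities. [bookkeeping; `decide +kernel`] -/
theorem face10_G10Q : checkFaceEq 4 0 RAYS_G10Q CONES_G10Q RAYS_G10 CONES_G10 = true := by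
  decide +kernel

/-- **THE GLUING RECORD IN ONE CONJUNCTION**: `Σ₄|{x₃=0} = G9`, `Σ₄|{x₂=0} = G10`, `G10Q|{x₀=0} = G10` (all as `checkFaceEq` equalities of cone sets), and E-adaptedness of all four
fans (`Σ₄` for the boundary pair `{2,3}`; G9/G10 for letter `2`; G10Q for letter `3`). [bookkeeping] -/
theorem omega1_fan_of_record_glues : checkFaceEq 4 3 RAYS_G4 CONES_G4 RAYS_G9 CONES_G9 = true ∧ checkFaceEq 4 2 RAYS_G4 CONES_G4 RAYS_G10 CONES_G10 = true ∧
    checkFaceEq 4 0 RAYS_G10Q CONES_G10Q RAYS_G10 CONES_G10 = true ∧ checkBoundaryRaysB 4 [2, 3] RAYS_G4 = true ∧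
    checkBoundaryRays 3 2 RAYS_G9 = true ∧ checkBoundaryRays 3 2 RAYS_G10 = true ∧ checkBoundaryRays 4 3 RAYS_G10Q = true :=
  ⟨face9_G4, face10_G4, face10_G10Q, cert_G4_boundary, cert_G9.2.2.2.1, cert_G10.2.2.2.1, cert_G10Q.2.2.2.1⟩

end Summit.ResolutionOfSingularities.ResolutionOfSingularities.Theorems.FInjectiveMacaulayfication.OmegaCrossingCureRow

end
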